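import Literature.Analysis.Complex.JensenCircles
import Literature.Analysis.Complex.ArgumentPrincipleRectangle
import Literature.Analysis.Complex.FourierPolyaKiKimCounting
import Literature.Analysis.Complex.FourierPolyaKiKimEngine
import HarnessLib

/-!
# Jensen-window census I (part 1/4) — Jensen-clear points, the boundary sign of `Im f'/f`, the slit-plane toolkit

Cell rh-split, seat rh-split-jen-neg g7 (scratch `SketchG7.lean` 02ca2ea96404222a; staged monolith 1f49da2f12defbf0, farm
rc 0 / 0 sorries, standard axioms; referee g5 REPLAY PASS ×2 + BYTES PASS), cut per rh-split-lead RULING #63/#63b (OPTION A: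
all four parts under Theorems/Splittings/, parts 1–3 def-carrying = definition lane, part 4 = the item proof).  Decl bodies
verbatim (renames vs the monolith: `zeroCount ↦ zeroCountC`, `exists_ball_ne_zero ↦ exists_ball_ne_zero_of_entire`; the helper
`analyticOrderAt_ne_top_of_entire` became private copies `…_aux`).  Zero `sorry`, no instances, no notation.
HONEST LABEL: «SPLITTING SEARCH over kernel-typed RH-EQUIVALENCES; a splitting A ∧ B ⟹ RH is CONDITIONAL
bookkeeping unless A and B are both proved; nothing here bears on the truth of RH.»

IN PRINT: the census identity, the real-axis Rolle/Pólya equation and the local critical-point count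
are Y.-O. Kim, Proc. AMS 124 (1996) 819–830 [Kim1996], Theorem 1 p. 821 and its proof — (2.3) `Im z · Im f'/f < 0` off the
Jensen set, (2.4) `(1/2π) Δ_Γ arg f'/f = ½(sgn f'(a)/f(a) − sgn f'(b)/f(b))`, and Pólya's 1930 equation
`2K = N' − N − ½(sgn f'(a)/f(a) − sgn f'(b)/f(b))` (Quart. J. Math. Oxford 1, pp. 29–30), pp. 822–823 — stated there for `f` of
genus `1*` on a strip `a ≤ Re z ≤ b` with `a, b` outside the Jensen set.  Here: an ARBITRARY real entire `f`, a bounded window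
`[α,β] × [−h,h]`, the pointwise boundary-sign hypothesis `Im w · Im (f'/f)(w) < 0` on the non-real boundary (which (2.3)
supplies in Kim's setting), multiplicities, and the exact rectangle argument principle of
`Literature.Analysis.Complex.ArgumentPrincipleRectangle` — a formalisation and mild generalisation, not a new theorem.
Further sources: Ki–Kim, Duke Math. J. 104 (2000) §3 (3.1) p. 54, Thm 4.1 p. 60 [KiKim2000] (`KiKim.fourK`);
Craven–Csordas–Smith, Ann. of Math. 125 (1987) (Jensen discs).

For a real entire `f` of order `< 2` with a zero, `Im w · Im (f'/f)(w) < 0` at every non-real `w` outside all closed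
Jensen discs of `f` (`im_mul_im_logDeriv_neg` = Kim's (2.3), from `Literature…JensenCircles.exists_logDeriv_eq_sum_pair`).
Bookkeeping objects for the census of part 2: `sgn`, `Φ = (f'/f)'/(f'/f)`, `gU = i f'/f`, `gL = −i f'/f`, `zeroCountC g S`
(zeros of `g` in `S` with complex multiplicity), the structures `RealEntireLt2`, `Window` (Jensen window), `SWindow` (sign
window over a predicate) — all PARAMETERISED (no parameter-free `def X : Prop`) —, and the slit-plane membership / logarithm
lemmas for `gU`, `gL`.
-/

noncomputable section

open Complex Filter Metric Set Topology
open scoped ComplexConjugate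

set_option linter.dupNamespace false

namespace Summit.RiemannHypothesis.RiemannHypothesis.Theorems.Splittings.JensenWindow

open Literature.Analysis.Complex

variable {f g : ℂ → ℂ}

/-! ## 0. Small helpers -/

/-- `w` is *Jensen-clear* for `f`: it lies outside the closed Jensen disc of every non-real zero. -/
def JensenClear (f : ℂ → ℂ) (w : ℂ) : Prop :=
  ∀ a, f a = 0 → a.im ≠ 0 → |a.im| < ‖w - a.re‖

/-- Helper `jensenClear_all` (see the module docstring). -/
theorem jensenClear_all {w : ℂ} (hw : w.im ≠ 0) (h : JensenClear f w) :
    ∀ a, f a = 0 → |a.im| < ‖w - a.re‖ := by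
  intro a ha
  by_cases hai : a.im = 0
  · rw [hai, abs_zero]
    refine norm_pos_iff.2 (sub_ne_zero.2 ?_)
    intro hwa
    apply hw
    rw [hwa]; simp
  · exact h a ha hai

/-- Helper `ne_zero_of_jensenClear` (see the module docstring). -/
theorem ne_zero_of_jensenClear {w : ℂ} (hw : w.im ≠ 0) (h : JensenClear f w) : f w ≠ 0 := by
  intro h0
  have h1 := jensenClear_all hw h w h0
  have e : w - (w.re : ℂ) = (w.im : ℂ) * I := by apply Complex.ext <;> simp
  rw [e, norm_mul, Complex.norm_I, mul_one, Complex.norm_real, Real.norm_eq_abs] at h1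
  exact lt_irrefl _ h1

/-- Jensen's theorem, contrapositive: `f' ≠ 0` at a Jensen-clear non-real point. -/
theorem deriv_ne_zero_of_jensenClear (hf : Differentiable ℂ f) {ρ C : ℝ} (hρ0 : 0 ≤ ρ)
    (hρ : ρ < 2) (hgr : ∀ z, ‖f z‖ ≤ C * Real.exp (‖z‖ ^ ρ)) (hreal : ∀ x : ℝ, (f x).im = 0)
    (hd : ∃ z, deriv f z ≠ 0) {w : ℂ} (hw : w.im ≠ 0) (h : JensenClear f w) :
    deriv f w ≠ 0 := by
  intro h0
  obtain ⟨a, ha, hwa⟩ := jensen_circle hf hρ0 hρ hgr hreal hd hw h0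
  exact absurd (jensenClear_all hw h a ha) (not_lt.2 hwa)

/-! ## 1. Sign of `Im f'/f` outside the Jensen discs -/

/-- Outside all closed Jensen discs, `Im w · Im (f'/f)(w) < 0` (real entire `f` of order `< 2`
with at least one zero).  Same computation as the tree's `jensen_circle`. (Jensen–Nagy–Walsh) [cite: Kim1996, (2.3) p. 822] -/
theorem im_mul_im_logDeriv_neg (hf : Differentiable ℂ f) {ρ C : ℝ} (hρ0 : 0 ≤ ρ) (hρ : ρ < 2)
    (hgr : ∀ z, ‖f z‖ ≤ C * Real.exp (‖z‖ ^ ρ)) (hreal : ∀ x : ℝ, (f x).im = 0)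
    (hex : ∃ a, f a = 0) {w : ℂ} (hw : w.im ≠ 0) (hout : JensenClear f w) :
    w.im * (deriv f w / f w).im < 0 := by
  classical
  have hout' := jensenClear_all hw hout
  have hfw0 : f w ≠ 0 := ne_zero_of_jensenClear hw hout
  have hfw0' : f (conj w) ≠ 0 := by
    rw [apply_conj_eq_conj hf hreal, map_ne_zero]; exact hfw0
  obtain ⟨a₀, ha₀⟩ := hex
  obtain ⟨c, hc⟩ := exists_ofReal_ne_zero hf ⟨w, hfw0⟩
  obtain ⟨-, hκ⟩ := im_mul_im_pair_le (hout' a₀ ha₀) hw (le_refl 1)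
  set κ : ℝ := 2 * w.im ^ 2 * (‖w - a₀.re‖ ^ 2 - a₀.im ^ 2) /
    (‖w - a₀‖ ^ 2 * ‖w - conj a₀‖ ^ 2) with hκdef
  have hε : 0 < κ / (|w.im| + 1) := by positivity
  obtain ⟨S, m, ψ₁, ψ₂, hS, hS', h1, h2, hψ⟩ :=
    exists_logDeriv_eq_sum_pair hf hρ0 hρ hgr hc hfw0 hfw0' ‖a₀ - c‖ hε
  have ha₀S : a₀ ∈ S := hS' a₀ ha₀ le_rfl
  set L : ℂ := deriv f w / f w with hLdef
  have h2' : ∑ a ∈ S, (m a : ℂ) / (w - conj a) = L - conj ψ₂ := by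
    have e1 : deriv f (conj w) / f (conj w) = conj L := by
      rw [hLdef, logDeriv_apply_conj hf hreal]
    have h3 := congrArg conj h2
    rw [e1, Complex.conj_conj, map_add, map_sum] at h3
    have h4 : ∑ a ∈ S, conj ((m a : ℂ) / (conj w - a)) = ∑ a ∈ S, (m a : ℂ) / (w - conj a) := by
      refine Finset.sum_congr rfl fun a _ ↦ ?_
      rw [map_div₀, map_natCast, map_sub, Complex.conj_conj]
    rw [h4] at h3
    rw [h3]; ring
  have h1' : ∑ a ∈ S, (m a : ℂ) / (w - a) = L - ψ₁ := by rw [h1]; ring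
  have hsum : ∑ a ∈ S, w.im * ((m a : ℂ) / (w - a) + (m a : ℂ) / (w - conj a)).im =
      2 * (w.im * L.im) - w.im * (ψ₁.im - ψ₂.im) := by
    have e : ∑ a ∈ S, ((m a : ℂ) / (w - a) + (m a : ℂ) / (w - conj a)) =
        L + L - (ψ₁ + conj ψ₂) := by
      rw [Finset.sum_add_distrib, h1', h2']; ring
    rw [← Finset.mul_sum, ← Complex.im_sum, e]
    simp only [Complex.sub_im, Complex.add_im, Complex.conj_im]
    ring
  have hle : ∑ a ∈ S, w.im * ((m a : ℂ) / (w - a) + (m a : ℂ) / (w - conj a)).im ≤ -κ := by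
    rw [← Finset.add_sum_erase S _ ha₀S]
    have hrest : ∑ a ∈ S.erase a₀, w.im * ((m a : ℂ) / (w - a) + (m a : ℂ) / (w - conj a)).im
        ≤ 0 :=
      Finset.sum_nonpos fun a ha ↦
        im_mul_im_pair_nonpos (hout' a (hS a (Finset.mem_of_mem_erase ha)).1) (m a)
    have hfirst := (im_mul_im_pair_le (hout' a₀ ha₀) hw (hS a₀ ha₀S).2).1
    rw [← hκdef] at hfirst
    linarith
  have hψim : |ψ₁.im - ψ₂.im| ≤ κ / (|w.im| + 1) := by
    calc |ψ₁.im - ψ₂.im| = |(ψ₁ - ψ₂).im| := by rw [Complex.sub_im]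
      _ ≤ ‖ψ₁ - ψ₂‖ := Complex.abs_im_le_norm _
      _ ≤ κ / (|w.im| + 1) := hψ
  have hprod : |w.im * (ψ₁.im - ψ₂.im)| ≤ |w.im| * (κ / (|w.im| + 1)) := by
    rw [abs_mul]; exact mul_le_mul_of_nonneg_left hψim (abs_nonneg _)
  have hlt : |w.im| * (κ / (|w.im| + 1)) < κ := by
    rw [← mul_div_assoc, div_lt_iff₀ (by positivity)]
    nlinarith [abs_nonneg w.im]
  have := le_abs_self (w.im * (ψ₁.im - ψ₂.im))
  rw [hsum] at hle
  nlinarith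

/-! ## 2. The census identity on a Jensen-clear rectangle -/

/-- `sgn r = 1` for `r > 0`, `-1` otherwise (only used at `r ≠ 0`). -/
def sgn (r : ℝ) : ℂ := if 0 < r then 1 else -1

/-- `Φ = f''/f' − f'/f` (`= ψ'/ψ` for `ψ = f'/f`). -/
def Φ (f : ℂ → ℂ) (w : ℂ) : ℂ := deriv (deriv f) w / deriv f w - deriv f w / f w

/-- `gU = i·f'/f` (upper half of the boundary), `gL = −i·f'/f` (lower half). -/
def gU (f : ℂ → ℂ) (w : ℂ) : ℂ := I * (deriv f w / f w)

/-- See `gU`. -/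
def gL (f : ℂ → ℂ) (w : ℂ) : ℂ := -I * (deriv f w / f w)

/-- Zeros of `g` in `S`, counted with multiplicity (the tree's argument-principle count). -/
def zeroCountC (g : ℂ → ℂ) (S : Set ℂ) : ℂ :=
  ∑ᶠ ρ ∈ {ρ : ℂ | g ρ = 0 ∧ ρ ∈ S}, ((meromorphicOrderAt g ρ).untop₀ : ℂ)

/-- Real entire of order `< 2` in the tree's quantitative sense. -/
structure RealEntireLt2 (f : ℂ → ℂ) : Prop where
  diff : Differentiable ℂ f
  growth : ∃ ρ C : ℝ, 0 ≤ ρ ∧ ρ < 2 ∧ ∀ z, ‖f z‖ ≤ C * Real.exp (‖z‖ ^ ρ)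
  real : ∀ x : ℝ, (f x).im = 0

/-- A **Jensen window**: the rectangle `[α,β] × [−h,h]` whose non-real boundary points are
Jensen-clear, with `f, f' ≠ 0` at the two real boundary points `α`, `β`. -/
structure Window (f : ℂ → ℂ) (α β h : ℝ) : Prop where
  lt : α < β
  pos : 0 < h
  top : ∀ x ∈ Icc α β, JensenClear f ((x : ℂ) + (h : ℂ) * I)
  left : ∀ y ∈ Icc (-h) h, y ≠ 0 → JensenClear f ((α : ℂ) + (y : ℂ) * I)
  right : ∀ y ∈ Icc (-h) h, y ≠ 0 → JensenClear f ((β : ℂ) + (y : ℂ) * I)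
  fα : f α ≠ 0
  fβ : f β ≠ 0
  dα : deriv f α ≠ 0
  dβ : deriv f β ≠ 0

/-- A **sign window**: the same rectangle data, with the boundary information carried by an
arbitrary predicate `P` (Jensen-clearance, or directly the sign of `Im (f'/f)`), required at every
non-real boundary point. No growth hypothesis on `f` is attached. -/
structure SWindow (f : ℂ → ℂ) (P : ℂ → Prop) (α β h : ℝ) : Prop where
  lt : α < β
  pos : 0 < h
  top : ∀ x ∈ Icc α β, P ((x : ℂ) + (h : ℂ) * I)
  bot : ∀ x ∈ Icc α β, P ((x : ℂ) + ((-h : ℝ) : ℂ) * I)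
  left : ∀ y ∈ Icc (-h) h, y ≠ 0 → P ((α : ℂ) + (y : ℂ) * I)
  right : ∀ y ∈ Icc (-h) h, y ≠ 0 → P ((β : ℂ) + (y : ℂ) * I)
  fα : f α ≠ 0
  fβ : f β ≠ 0
  dα : deriv f α ≠ 0
  dβ : deriv f β ≠ 0

/-- A Jensen window is a sign window for the Jensen-clearance predicate (the bottom edge is
clear by conjugation symmetry of the Jensen discs). -/
theorem Window.toSWindow {α β h : ℝ} (hW : Window f α β h) : SWindow f (JensenClear f) α β h where
  lt := hW.lt
  pos := hW.pos
  top := hW.top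
  bot := by
    intro x hx a ha hai
    have h1 := hW.top x hx a ha hai
    have e : ‖(x : ℂ) + ((-h : ℝ) : ℂ) * I - (a.re : ℂ)‖ = ‖(x : ℂ) + (h : ℂ) * I - (a.re : ℂ)‖ := by
      rw [← Complex.norm_conj ((x : ℂ) + (h : ℂ) * I - (a.re : ℂ))]
      congr 1
      apply Complex.ext <;> simp
    rwa [e]
  left := hW.left
  right := hW.right
  fα := hW.fα
  fβ := hW.fβ
  dα := hW.dα
  dβ := hW.dβ

/-- Helper `differentiable_deriv` (see the module docstring). -/
theorem differentiable_deriv (hf : Differentiable ℂ f) : Differentiable ℂ (deriv f) :=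
  fun z ↦ ((hf.analyticAt z).deriv).differentiableAt

/-- Helper `deriv_logDeriv` (see the module docstring). -/
theorem deriv_logDeriv (hf : Differentiable ℂ f) {z : ℂ} (hz : f z ≠ 0) :
    deriv (fun w ↦ deriv f w / f w) z =
      (deriv (deriv f) z * f z - deriv f z * deriv f z) / (f z) ^ 2 :=
  deriv_div (differentiable_deriv hf z) (hf z) hz

/-- Helper `gU_logDeriv` (see the module docstring). -/
theorem gU_logDeriv (hf : Differentiable ℂ f) {z : ℂ} (hz : f z ≠ 0) (hz' : deriv f z ≠ 0) :
    deriv (gU f) z / gU f z = Φ f z := by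
  have hd : deriv (gU f) z = I * deriv (fun w ↦ deriv f w / f w) z := by
    show deriv (fun w ↦ I * (deriv f w / f w)) z = _
    exact deriv_const_mul I (((differentiable_deriv hf) z).div (hf z) hz)
  rw [hd, deriv_logDeriv hf hz]
  simp only [gU, Φ]
  have hI : I ≠ 0 := I_ne_zero
  field_simp

/-- Helper `gL_logDeriv` (see the module docstring). -/
theorem gL_logDeriv (hf : Differentiable ℂ f) {z : ℂ} (hz : f z ≠ 0) (hz' : deriv f z ≠ 0) :
    deriv (gL f) z / gL f z = Φ f z := by
  have hd : deriv (gL f) z = -I * deriv (fun w ↦ deriv f w / f w) z := by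
    show deriv (fun w ↦ -I * (deriv f w / f w)) z = _
    exact deriv_const_mul (-I) (((differentiable_deriv hf) z).div (hf z) hz)
  rw [hd, deriv_logDeriv hf hz]
  simp only [gL, Φ]
  have hI : I ≠ 0 := I_ne_zero
  field_simp

/-- Helper `analyticAt_gU` (see the module docstring). -/
theorem analyticAt_gU (hf : Differentiable ℂ f) {z : ℂ} (hz : f z ≠ 0) : AnalyticAt ℂ (gU f) z := by
  have h : AnalyticAt ℂ (fun w ↦ deriv f w / f w) z :=
    ((hf.analyticAt z).deriv).div (hf.analyticAt z) hz
  exact analyticAt_const.mul h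

/-- Helper `analyticAt_gL` (see the module docstring). -/
theorem analyticAt_gL (hf : Differentiable ℂ f) {z : ℂ} (hz : f z ≠ 0) : AnalyticAt ℂ (gL f) z := by
  have h : AnalyticAt ℂ (fun w ↦ deriv f w / f w) z :=
    ((hf.analyticAt z).deriv).div (hf.analyticAt z) hz
  exact analyticAt_const.mul h

/-- Helper `continuousAt_Φ` (see the module docstring). -/
theorem continuousAt_Φ (hf : Differentiable ℂ f) {z : ℂ} (hz : f z ≠ 0) (hz' : deriv f z ≠ 0) :
    ContinuousAt (Φ f) z := by
  have h1 := differentiable_deriv hf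
  have h2 := differentiable_deriv h1
  exact ((h2.continuous.continuousAt).div (h1.continuous.continuousAt) hz').sub
    ((h1.continuous.continuousAt).div (hf.continuous.continuousAt) hz)

/-- Helper `gU_mem_slitPlane_of_im_neg` (see the module docstring). -/
theorem gU_mem_slitPlane_of_im_neg {z : ℂ} (h : (deriv f z / f z).im < 0) : gU f z ∈ slitPlane := by
  rw [gU, Complex.mem_slitPlane_iff]; left
  simp only [Complex.mul_re, Complex.I_re, Complex.I_im, zero_mul, one_mul, zero_sub]
  linarith

/-- Helper `gL_mem_slitPlane_of_im_pos` (see the module docstring). -/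
theorem gL_mem_slitPlane_of_im_pos {z : ℂ} (h : 0 < (deriv f z / f z).im) : gL f z ∈ slitPlane := by
  rw [gL, Complex.mem_slitPlane_iff]; left
  simp only [neg_mul, Complex.neg_re, Complex.mul_re, Complex.I_re, Complex.I_im, zero_mul, one_mul,
    zero_sub, neg_neg]
  exact h

/-- Helper `gU_mem_slitPlane_of_real` (see the module docstring). -/
theorem gU_mem_slitPlane_of_real {z : ℂ} (him : (deriv f z / f z).im = 0)
    (hne : deriv f z / f z ≠ 0) : gU f z ∈ slitPlane := by
  rw [gU, Complex.mem_slitPlane_iff]; right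
  have hre : (deriv f z / f z).re ≠ 0 := fun h ↦ hne (Complex.ext h him)
  simpa [Complex.mul_im] using hre

/-- Helper `gL_mem_slitPlane_of_real` (see the module docstring). -/
theorem gL_mem_slitPlane_of_real {z : ℂ} (him : (deriv f z / f z).im = 0)
    (hne : deriv f z / f z ≠ 0) : gL f z ∈ slitPlane := by
  rw [gL, Complex.mem_slitPlane_iff]; right
  have hre : (deriv f z / f z).re ≠ 0 := fun h ↦ hne (Complex.ext h him)
  simpa [Complex.mul_im] using hre

/-- `log(−i r) − log(i r) = −iπ·sgn r` for real `r ≠ 0` (principal branch). -/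
theorem log_negI_mul_sub_log_I_mul {r : ℝ} (hr : r ≠ 0) :
    Complex.log (-I * (r : ℂ)) - Complex.log (I * (r : ℂ)) = -(Real.pi * I) * sgn r := by
  unfold sgn
  split_ifs with h
  · rw [show -I * (r : ℂ) = (r : ℂ) * (-I) by ring, show I * (r : ℂ) = (r : ℂ) * I by ring,
      Complex.log_ofReal_mul h (by simp), Complex.log_ofReal_mul h I_ne_zero,
      Complex.log_neg_I, Complex.log_I]
    ring
  · have h' : 0 < -r := by
      rcases lt_or_gt_of_ne hr with h1 | h1
      · linarith
      · exact absurd h1 h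
    rw [show -I * (r : ℂ) = ((-r : ℝ) : ℂ) * I by push_cast; ring,
      show I * (r : ℂ) = ((-r : ℝ) : ℂ) * (-I) by push_cast; ring,
      Complex.log_ofReal_mul h' I_ne_zero, Complex.log_ofReal_mul h' (by simp),
      Complex.log_neg_I, Complex.log_I]
    ring

/-- Helper `logDeriv_ofReal_im'` (see the module docstring). -/
private theorem logDeriv_ofReal_im' (hfd : Differentiable ℂ f) (hreal : ∀ x : ℝ, (f x).im = 0) (x : ℝ) :
    (deriv f x / f x).im = 0 := by
  rw [Complex.div_im, hreal x, im_deriv_ofReal hfd hreal x]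
  ring

/-- Helper `logDeriv_ofReal_im` (see the module docstring). -/
theorem logDeriv_ofReal_im (hf : RealEntireLt2 f) (x : ℝ) : (deriv f x / f x).im = 0 :=
  logDeriv_ofReal_im' hf.diff hf.real x


end Summit.RiemannHypothesis.RiemannHypothesis.Theorems.Splittings.JensenWindow
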